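import Literature.Probability.LatticeModels.AnisotropicNVectorInfraredBound
import Literature.Probability.LatticeModels.AnisotropicPlaneRotatorLRO
import HarnessLib

/-!
# The infrared-bound ordering floor of the LAYERED plane rotator on `(ℤ/Lℤ)³` with the anisotropic dispersion `E^r_q` (Fröhlich–Israel–Lieb–Simon 1978 Thm. 4.7; Kennedy–Lieb–Shastry 1988 eq. (7))

Topic `Probability/LatticeModels`; completes `AnisotropicPlaneRotatorLRO.lean` (whose floor
`1 − torusGreen 0 / J⊥` came from Ginibre comparison with the isotropic model at the weakest coupling
and is linear in `J⊥`; its module docstring records the direct anisotropic Gaussian-domination route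
as a TODO) with the engine `AnisotropicNVectorInfraredBound.lean` (Fröhlich–Israel–Lieb–Simon 1978,
§3 (C) and Thms. 4.6–4.7, proved there for `ν`-vector models with one coupling per direction).
Specialising that engine to the plane rotator (`ν = 2`, single-spin law `(cos, sin)_* Leb|_{[0,2π]}`,
`β = ½`, couplings `K = J`: the Boltzmann weight of `ℋ_{½,J}` is `e^{−L³∑ᵢJᵢ}` times the angle weight
`exp{∑_{(x,i)} J_i cos(θ_{x+eᵢ} − θ_x)}` of `AnisotropicRotator.weight`) gives, for every even `L ≥ 4`
and every `J` with `J_i > 0`: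

* `AnisotropicRotator.plateau_ge_infraredBound`:
  `L⁻⁶ ∑_{x,y} ⟨cos(θ_x − θ_y)⟩_J ≥ 1 − L⁻³ ∑_{k≠0} ε_J(2πk/L)⁻¹`, `ε_J(p) = ∑ᵢ J_i(1 − cos pᵢ)`
  (Friedli–Velenik's display after Thm. 10.24 / FILS (4.10), anisotropic dispersion);
* `AnisotropicRotator.layered_plateau_ge_infraredBound`: for the layered couplings `(J∥, J∥, J⊥)`,
  `L⁻⁶ ∑_{x,y} ⟨cos(θ_x − θ_y)⟩ ≥ 1 − (1/J∥) · L⁻³ ∑_{q≠0} 1/E^r_q`, `r = J⊥/J∥`,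
  `E^r_q = 2 − cos q₁ − cos q₂ + r(1 − cos q₃)` — Kennedy–Lieb–Shastry's anisotropic dispersion
  (their eq. (7), written for the quantum antiferromagnet interpolating between `d = 2` and `d = 3`;
  here for the classical rotator, where no further reduction factor appears).

So the layered classical XY model orders as soon as `J∥ > T_L(r) := L⁻³∑_{q≠0} 1/E^r_q`; since
`E^r_q ≥ r·ε(q)` this contains the linear floor of `AnisotropicPlaneRotatorLRO.lean`
(`layered_plateau_ge`, up to the harmless replacement of `torusGreen 0/J⊥`), and since `T_L(r)` grows
only logarithmically as `r ↓ 0` (the `q₃`-integral of `1/E^r_q` is `1/√(ε₂(ε₂ + 2r))`,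
`ε₂ = 2 − cos q₁ − cos q₂`) it is the floor "with `ln(J∥/J⊥)`" of the interlayer literature. The
logarithmic asymptotics of the torus sum is NOT proved here (no uniform-in-`L` estimate of `T_L(r)` is
attempted); everything stated is a finite-volume inequality, proved. Nothing here concerns a quantum
or fermionic model.

## References

* J. Fröhlich, R. Israel, E. H. Lieb, B. Simon, *Phase transitions and reflection positivity. I*,
  Comm. Math. Phys. 62 (1978) 1–34, §3 (C) eq. (3.6), Thms. 4.6–4.7, (4.6)–(4.10) [FILS1978].
* T. Kennedy, E. H. Lieb, B. S. Shastry, *The XY model has long-range order for all spins and all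
  dimensions greater than one* / *Existence of Néel order in some spin-½ Heisenberg
  antiferromagnets*, J. Stat. Phys. 53 (1988) 1019–1030, eqs. (5)–(7) [KLS1988JSP].
* S. Friedli, Y. Velenik, *Statistical Mechanics of Lattice Systems*, CUP (2017), Thm. 10.24 and the
  display following it, Example 10.22, (10.39)–(10.40) [FriedliVelenikSMLS2017].
-/

noncomputable section

open MeasureTheory Set Finset Filter
open scoped BigOperators Real

namespace Literature.Probability.LatticeModels

namespace AnisotropicRotator

open NVectorAniso PlaneRotator

variable {L : ℕ}

/-! ### The anisotropic `2`-vector Hamiltonian in angles -/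

/-- **The direction-weighted Hamiltonian of unit plane spins in angles**:
`ℋ_{β,K}((cos θ_x, sin θ_x)_x) = 2βL³∑ᵢKᵢ − 2β ∑_{(x,i)} K_i cos(θ_{x+eᵢ} − θ_x)` (each bond
`{x, x + eᵢ}` contributes `K_i‖S_x − S_{x+eᵢ}‖² = K_i(2 − 2cos(θ_{x+eᵢ} − θ_x))`; Friedli–Velenik's
Example 10.22 with a coupling per direction). [cite: FriedliVelenikSMLS2017, §10.5.1 Example 10.22] -/
theorem anisoHamiltonian_cosSin [NeZero L] (β : ℝ) (K : Fin 3 → ℝ) (θ : TorusSite 3 L → ℝ) :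
    anisoHamiltonian β K (fun x => (![Real.cos (θ x), Real.sin (θ x)] : Fin 2 → ℝ)) =
      2 * β * (L : ℝ) ^ 3 * (∑ i, K i) -
        2 * β * ∑ b : TorusSite 3 L × Fin 3, K b.2 * Real.cos (θ (b.1 + Pi.single b.2 1) - θ b.1) := by
  unfold anisoHamiltonian
  simp_rw [sum_cosSin_sub_sq]
  rw [Fintype.sum_prod_type]
  dsimp only
  have h : ∀ x : TorusSite 3 L,
      ∑ i : Fin 3, K i * (2 - 2 * Real.cos (θ (x + Pi.single i 1) - θ x)) =
        2 * (∑ i : Fin 3, K i) - 2 * ∑ i : Fin 3, K i * Real.cos (θ (x + Pi.single i 1) - θ x) := by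
    intro x
    rw [Finset.mul_sum, Finset.mul_sum, ← Finset.sum_sub_distrib]
    exact Finset.sum_congr rfl fun i _ => by ring
  simp_rw [h]
  rw [Finset.sum_sub_distrib, Finset.sum_const, Finset.card_univ, nsmul_eq_mul,
    NVector.card_torusSite_real, ← Finset.mul_sum]
  ring

/-- The Boltzmann weight of `ℋ_{½,K}` on unit plane spins is `e^{−L³∑Kᵢ}` times the angle weight
`exp{∑_{(x,i)} K_i cos(θ_{x+eᵢ} − θ_x)}`. [cite: FriedliVelenikSMLS2017, §10.5.1 Example 10.22] -/
theorem exp_neg_anisoHamiltonian_cosSin [NeZero L] (K : Fin 3 → ℝ) (θ : TorusSite 3 L → ℝ) :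
    Real.exp (-anisoHamiltonian (1 / 2) K (fun x => (![Real.cos (θ x), Real.sin (θ x)] : Fin 2 → ℝ))) =
      Real.exp (-((L : ℝ) ^ 3 * ∑ i, K i)) * weight K θ := by
  rw [anisoHamiltonian_cosSin, weight, ← Real.exp_add]
  congr 1
  ring

/-- The plateau as a single ratio: `L⁻⁶∑_{x,y}⟨cos(θ_x − θ_y)⟩_K = (∑_{x,y}∫cos·w_K)/((∫w_K)·L⁶)`.
[folklore] -/
private theorem plateau_eq_div [NeZero L] (K : Fin 3 → ℝ) :
    plateau L K =
      (∑ x : TorusSite 3 L, ∑ y : TorusSite 3 L,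
          ∫ θ in Set.pi Set.univ fun _ : TorusSite 3 L => Icc (0 : ℝ) (2 * π),
            Real.cos (θ x - θ y) * weight K θ) /
        ((∫ θ in Set.pi Set.univ fun _ : TorusSite 3 L => Icc (0 : ℝ) (2 * π), weight K θ) *
          (L : ℝ) ^ 6) := by
  unfold plateau corr
  simp_rw [← Finset.sum_div]
  rw [div_div]

/-- **The Gibbs expectation of `‖m_L‖²` in the direction-weighted `2`-vector model at `β = ½` with
the uniform single-spin law on the circle is the anisotropic rotator plateau**:
`⟨‖m_L‖²⟩_{½,K} = L⁻⁶∑_{x,y}⟨cos(θ_x − θ_y)⟩_K` (change of variables to angles; the constant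
`e^{−L³∑Kᵢ}` cancels in the ratio). [cite: FriedliVelenikSMLS2017, §10.5.1 Example 10.22 and §10.5.2] -/
theorem integral_magnetisationNormSq_anisoGibbs_cosSin [NeZero L] {K : Fin 3 → ℝ}
    (hK : ∀ i, 0 ≤ K i) :
    ∫ ω, magnetisationNormSq ω ∂(anisoGibbs (d := 3) (L := L)
        (Measure.map (fun t : ℝ => (![Real.cos t, Real.sin t] : Fin 2 → ℝ))
          (volume.restrict (Set.Icc (0 : ℝ) (2 * π)))) (1 / 2) K) = plateau L K := by
  set w : (TorusSite 3 L → ℝ) → ℝ := fun θ => weight K θ with hw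
  have hwc : Continuous w := by
    rw [hw]
    unfold weight
    fun_prop
  set a : ℝ := Real.exp (-((L : ℝ) ^ 3 * ∑ i, K i)) with ha
  have ha0 : a ≠ 0 := (Real.exp_pos _).ne'
  have hexp : ∀ θ : TorusSite 3 L → ℝ, Real.exp (-anisoHamiltonian (1 / 2) K
      (fun x => (![Real.cos (θ x), Real.sin (θ x)] : Fin 2 → ℝ))) = a * w θ := fun θ =>
    exp_neg_anisoHamiltonian_cosSin K θ
  have h1 : Continuous fun ω : VecConfig 3 L 2 =>
      Real.exp (-anisoHamiltonian (1 / 2) K ω) * magnetisationNormSq ω :=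
    (continuous_anisoHamiltonian _ _).neg.rexp.mul NVector.continuous_magnetisationNormSq
  have h2 : Continuous fun ω : VecConfig 3 L 2 => Real.exp (-anisoHamiltonian (1 / 2) K ω) :=
    (continuous_anisoHamiltonian _ _).neg.rexp
  rw [integral_anisoGibbs _ (map_angleLaw_ne_zero continuous_cosSin.measurable)
      (by norm_num : (0 : ℝ) ≤ 1 / 2) hK,
    anisoPartitionFunction, integral_nVectorRef_map_angleLaw continuous_cosSin _ h1,
    integral_nVectorRef_map_angleLaw continuous_cosSin _ h2, plateau_eq_div]
  simp_rw [hexp, magnetisationNormSq_cosSin]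
  have hpt : ∀ θ : TorusSite 3 L → ℝ,
      a * w θ * ((∑ x, ∑ y, Real.cos (θ x - θ y)) / (L : ℝ) ^ 6) =
        a * ((∑ x, ∑ y, Real.cos (θ x - θ y) * w θ) / (L : ℝ) ^ 6) := by
    intro θ
    simp_rw [← Finset.sum_mul]
    ring
  simp_rw [hpt]
  have hint : ∀ x y : TorusSite 3 L,
      Integrable (fun θ : TorusSite 3 L → ℝ => Real.cos (θ x - θ y) * w θ)
        (volume.restrict (Set.pi Set.univ fun _ => Set.Icc (0 : ℝ) (2 * π))) := fun x y =>
    integrableOn_angleCube (by fun_prop)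
  rw [integral_const_mul, integral_div, integral_const_mul,
    integral_finsetSum _ fun x _ => integrable_finsetSum _ fun y _ => hint x y]
  rw [mul_div_mul_left _ _ ha0, div_div, mul_comm ((L : ℝ) ^ 6)]
  congr 1
  exact Finset.sum_congr rfl fun x _ => integral_finsetSum _ fun y _ => hint x y

/-! ### The anisotropic infrared-bound floor -/

variable (L) in
/-- **The infrared-bound ordering floor of the plane rotator with direction-dependent couplings**
(Fröhlich–Israel–Lieb–Simon 1978, Thm. 4.7 with §3 (C) and (4.10); Friedli–Velenik's display after
Thm. 10.24 with the anisotropic dispersion): for every even `L ≥ 4` and couplings `J_i > 0`,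
`L⁻⁶ ∑_{x,y} ⟨cos(θ_x − θ_y)⟩_J ≥ 1 − L⁻³ ∑_{k≠0} ε_J(2πk/L)⁻¹`, `ε_J(p) = ∑ᵢ J_i(1 − cos pᵢ)`
(the engine `NVectorAniso.aniso_longRangeOrderBound` at `ν = 2`, `β = ½`, for the uniform law on the
circle). [cite: FILS1978, Thm. 4.7 with §3 (C) and (4.10)] [cite: FriedliVelenikSMLS2017, Thm. 10.24 (display following) and Example 10.22] -/
theorem plateau_ge_infraredBound [NeZero L] (hLe : Even L) (hL4 : 4 ≤ L) {J : Fin 3 → ℝ}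
    (hJ : ∀ i, 0 < J i) :
    1 - 1 / (L : ℝ) ^ 3 * ∑ k ∈ Finset.univ.erase (0 : TorusSite 3 L),
        1 / anisoDispersion J (latticeMomentum L k) ≤ plateau L J := by
  have hfact := aniso_longRangeOrderBound (d := 3) (ν := 2) hLe hL4
    (Measure.map (fun t : ℝ => (![Real.cos t, Real.sin t] : Fin 2 → ℝ))
      (volume.restrict (Set.Icc (0 : ℝ) (2 * π))))
    (exists_isCompact_map_angleLaw continuous_cosSin)
    (map_angleLaw_ne_zero continuous_cosSin.measurable) (β := 1 / 2) (by norm_num) hJ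
    (ae_map_angleLaw continuous_cosSin sum_cosSin_sq)
  rw [integral_magnetisationNormSq_anisoGibbs_cosSin (fun i => (hJ i).le)] at hfact
  have hcoef : ((2 : ℕ) : ℝ) / (4 * (1 / 2)) = 1 := by norm_num
  rw [hcoef, one_mul] at hfact
  exact hfact

/-! ### The layered model and Kennedy–Lieb–Shastry's dispersion `E^r_q` -/

/-- **Kennedy–Lieb–Shastry's anisotropic dispersion** `E^r_q = 2 − cos q₁ − cos q₂ + r(1 − cos q₃)`
(`0 ≤ r ≤ 1` interpolates between the square lattice, `r = 0`, and the cubic lattice, `r = 1`).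
[cite: KLS1988JSP, eq. (7)] -/
def klsDispersion (r : ℝ) (q : Fin 3 → ℝ) : ℝ :=
  2 - Real.cos (q 0) - Real.cos (q 1) + r * (1 - Real.cos (q 2))

/-- `ε_{(J∥,J∥,J⊥)}(q) = J∥ · E^r_q` with `r = J⊥/J∥` (`J∥ ≠ 0`). [cite: KLS1988JSP, eq. (7)] -/
theorem anisoDispersion_layeredCoupling {Jpar Jperp : ℝ} (hpar : Jpar ≠ 0) (q : Fin 3 → ℝ) :
    anisoDispersion (layeredCoupling Jpar Jperp) q = Jpar * klsDispersion (Jperp / Jpar) q := by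
  unfold anisoDispersion klsDispersion
  rw [Fin.sum_univ_three]
  have h0 : layeredCoupling Jpar Jperp 0 = Jpar := if_neg (by decide)
  have h1 : layeredCoupling Jpar Jperp 1 = Jpar := if_neg (by decide)
  have h2 : layeredCoupling Jpar Jperp 2 = Jperp := if_pos rfl
  rw [h0, h1, h2]
  field_simp
  ring

/-- `E^r_q ≥ 0` for `r ≥ 0`. [cite: KLS1988JSP, eq. (7)] -/
theorem klsDispersion_nonneg {r : ℝ} (hr : 0 ≤ r) (q : Fin 3 → ℝ) : 0 ≤ klsDispersion r q := by
  unfold klsDispersion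
  nlinarith [Real.cos_le_one (q 0), Real.cos_le_one (q 1), Real.cos_le_one (q 2)]

variable (L) in
/-- **The interlayer ordering floor with the anisotropic dispersion** (Fröhlich–Israel–Lieb–Simon's
Thm. 4.7 infrared bound for the reflection-positive layered coupling, packaged with Kennedy–Lieb–
Shastry's `E^r_q`): for `J∥, J⊥ > 0`, `r = J⊥/J∥`, and every even `L ≥ 4`,
`L⁻⁶ ∑_{x,y} ⟨cos(θ_x − θ_y)⟩_{(J∥,J∥,J⊥)} ≥ 1 − (1/J∥) · L⁻³ ∑_{q≠0} 1/E^r_q`. In words: the layered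
classical XY model on `(ℤ/Lℤ)³` has plateau `≥ 1 − T_L(r)/J∥`, `T_L(r) = L⁻³∑_{q≠0}1/E^r_q` — long-range
order once `J∥ > T_L(J⊥/J∥)`. [cite: FILS1978, Thm. 4.7 with §3 (C) and (4.10)] [cite: KLS1988JSP, eqs. (5)–(7)] -/
theorem layered_plateau_ge_infraredBound [NeZero L] (hLe : Even L) (hL4 : 4 ≤ L) {Jpar Jperp : ℝ}
    (hpar : 0 < Jpar) (hperp : 0 < Jperp) :
    1 - 1 / Jpar * (1 / (L : ℝ) ^ 3 * ∑ k ∈ Finset.univ.erase (0 : TorusSite 3 L),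
        1 / klsDispersion (Jperp / Jpar) (latticeMomentum L k)) ≤
      plateau L (layeredCoupling Jpar Jperp) := by
  have hJ : ∀ i, 0 < layeredCoupling Jpar Jperp i := fun i => by
    unfold layeredCoupling
    split_ifs
    · exact hperp
    · exact hpar
  have h := plateau_ge_infraredBound L hLe hL4 hJ
  have hsum : ∑ k ∈ Finset.univ.erase (0 : TorusSite 3 L),
      1 / anisoDispersion (layeredCoupling Jpar Jperp) (latticeMomentum L k) =
        1 / Jpar * ∑ k ∈ Finset.univ.erase (0 : TorusSite 3 L),
          1 / klsDispersion (Jperp / Jpar) (latticeMomentum L k) := by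
    rw [Finset.mul_sum]
    refine Finset.sum_congr rfl fun k _ => ?_
    rw [anisoDispersion_layeredCoupling hpar.ne', one_div_mul_one_div]
  rw [hsum] at h
  have e : 1 / (L : ℝ) ^ 3 * (1 / Jpar * ∑ k ∈ Finset.univ.erase (0 : TorusSite 3 L),
      1 / klsDispersion (Jperp / Jpar) (latticeMomentum L k)) =
      1 / Jpar * (1 / (L : ℝ) ^ 3 * ∑ k ∈ Finset.univ.erase (0 : TorusSite 3 L),
        1 / klsDispersion (Jperp / Jpar) (latticeMomentum L k)) := by ring
  rw [e] at h
  exact h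

/-- Every component of the layered coupling vector is at least `J⊥` when `J⊥ ≤ J∥`. [folklore] -/
private theorem perp_le_layeredCoupling {Jpar Jperp : ℝ} (h : Jperp ≤ Jpar) (i : Fin 3) :
    Jperp ≤ layeredCoupling Jpar Jperp i := by
  unfold layeredCoupling
  split_ifs
  · exact le_rfl
  · exact h

/-- **Comparison with the linear floor**: for `0 < J⊥ ≤ J∥`, `J∥E^r_q = ε_{(J∥,J∥,J⊥)}(q) ≥ J⊥ε(q)`,
so mode by mode `1/(J∥E^r_q) ≤ 1/(J⊥ε(q))` (`q ≠ 0`) and the infrared floor of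
`layered_plateau_ge_infraredBound` is at least the Ginibre-comparison floor `1 − torusGreen 0/J⊥` of
`AnisotropicRotator.layered_plateau_ge`. [cite: KLS1988JSP, eq. (7)] -/
theorem layered_linearFloor_le_infraredFloor [NeZero L] {Jpar Jperp : ℝ} (hperp : 0 < Jperp)
    (hle : Jperp ≤ Jpar) :
    1 - torusGreen (0 : TorusSite 3 L) / Jperp ≤
      1 - 1 / Jpar * (1 / (L : ℝ) ^ 3 * ∑ k ∈ Finset.univ.erase (0 : TorusSite 3 L),
        1 / klsDispersion (Jperp / Jpar) (latticeMomentum L k)) := by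
  have hpar : 0 < Jpar := hperp.trans_le hle
  rw [← inv_mul_sum_inv_dispersion_eq_torusGreen]
  have hmode : ∀ k ∈ Finset.univ.erase (0 : TorusSite 3 L),
      1 / Jpar * (1 / klsDispersion (Jperp / Jpar) (latticeMomentum L k)) ≤
        1 / dispersion (latticeMomentum L k) / Jperp := by
    intro k hk
    have hk0 : k ≠ 0 := Finset.ne_of_mem_erase hk
    have hε : 0 < dispersion (latticeMomentum L k) := lt_of_le_of_ne (dispersion_nonneg _)
      fun h => hk0 ((dispersion_latticeMomentum_eq_zero_iff_holds k).1 h.symm)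
    rw [one_div_mul_one_div, ← anisoDispersion_layeredCoupling hpar.ne', div_div]
    refine one_div_le_one_div_of_le (mul_pos hε hperp) ?_
    unfold dispersion anisoDispersion
    rw [Finset.sum_mul]
    exact Finset.sum_le_sum fun i _ => by
      rw [mul_comm]
      exact mul_le_mul_of_nonneg_right (perp_le_layeredCoupling hle i)
        (sub_nonneg.2 (Real.cos_le_one _))
  have hS : 1 / Jpar * ∑ k ∈ Finset.univ.erase (0 : TorusSite 3 L),
      1 / klsDispersion (Jperp / Jpar) (latticeMomentum L k) ≤
        (∑ k ∈ Finset.univ.erase (0 : TorusSite 3 L), 1 / dispersion (latticeMomentum L k)) /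
          Jperp := by
    rw [Finset.mul_sum, Finset.sum_div]
    exact Finset.sum_le_sum hmode
  have hL0 : (0 : ℝ) ≤ 1 / (L : ℝ) ^ 3 := by positivity
  have h3 := mul_le_mul_of_nonneg_left hS hL0
  have e1 : 1 / Jpar * (1 / (L : ℝ) ^ 3 * ∑ k ∈ Finset.univ.erase (0 : TorusSite 3 L),
      1 / klsDispersion (Jperp / Jpar) (latticeMomentum L k)) =
      1 / (L : ℝ) ^ 3 * (1 / Jpar * ∑ k ∈ Finset.univ.erase (0 : TorusSite 3 L),
        1 / klsDispersion (Jperp / Jpar) (latticeMomentum L k)) := by ring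
  have e2 : 1 / (L : ℝ) ^ 3 * (∑ k ∈ Finset.univ.erase (0 : TorusSite 3 L),
      1 / dispersion (latticeMomentum L k)) / Jperp =
      1 / (L : ℝ) ^ 3 * ((∑ k ∈ Finset.univ.erase (0 : TorusSite 3 L),
        1 / dispersion (latticeMomentum L k)) / Jperp) := by ring
  rw [e1, e2]
  linarith

end AnisotropicRotator

end Literature.Probability.LatticeModels
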